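import Literature.Probability.Percolation.QSMPolynomials
import Literature.Probability.Percolation.SequentialProbing
import HarnessLib

/-!
# The exploration of the column-enhanced cluster and the law of its transcript
# (Martineau–Severo 2019, §5: "Structure of the process")

Fourth file of the inline proof of `Literature.Probability.Percolation.martineauSevero_zd3_slabTorus`.
Martineau–Severo (Ann. Probab. 47 (2019), §5) couple the enhanced cluster `𝒞_ℋ^{p,s}(o)` on the
quotient `ℋ` with the `p`-cluster of `o'` on the cover `𝒢` through an algorithmic exploration:
edges of `ℋ` are "`p`-explored" one at a time (Step `2K+1`), fully open balls trigger an
"`s`-exploration" of fresh edges of the cover (Step `2K+2`), and "no vertex or edge will get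
explored more than once", so that every step reads FRESH independent coins. The probabilistic
content is then that the transcript of answers has the same law whether the coins are read on `ℋ`
(with the marks `α`) or on `𝒢`.

This file sets up that exploration for the column model of `QSMColumnModel.lean`, abstractly in
the graph on which the coins are read:

* `SlabTorus.Query`, `SlabTorus.HState`, `SlabTorus.nq`, `SlabTorus.hstep`, `SlabTorus.stateOf` —
  the `ℋ`-level state machine driven by Boolean answers: a state records the explored vertices
  `A`, the queried `ℋ`-edges `Q` (with the endpoint and direction each was queried from, `src`),
  the open ones `O`, and the columns `Y` whose bonus has been attempted; the next query is an
  unexplored edge of `E_L` at `A` if there is one (`p`-exploration first, so that a bonus is only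
  attempted after a complete round), else the bonus of an un-attempted column of `box L` all of
  whose `n` vertical edges are explored-open; an answer `true` to an edge query adds the far
  endpoint, an answer `true` to a column query adds the four neighbouring columns.
* `SlabTorus.bt` — the Boolean transcript of a probing history, and
  `SlabTorus.texpl enc` — the `SequentialProbing.Explorer` that probes, after history `h`, the
  coin set `enc b q` encoding the next query `q` of the state `stateOf b`, `b = bt h` (one coin for an
  edge query, `T` coins for a column query), with a defensive freshness guard that makes
  `Explorer.Fresh ∅` hold by construction (`texpl_fresh`); along genuine runs the guard is shown
  never to trigger by the users of this file.
* `SlabTorus.measureReal_bt_succ` — **the law of the transcript**: by the product formula for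
  fresh probes (`Explorer.le_measure_inter_setOf_step` / `measure_inter_setOf_step_le` of
  `SequentialProbing.lean`), `P(bt_{k+1} = b)` is an explicit function of `P(bt_k = ·)`, `p` and
  `T`, the SAME for every encoding `enc` whose probes are `qsize`-many genuine edges; hence two such
  explorations have equal transcript laws (`measureReal_bt_eq`) and equal probabilities of any
  event read off the transcript (`measureReal_setOf_bt_eq`).

The two instances — coins on `ℋ_n` plus `T` pendant "mark" edges per column (the `(p, p^T)` column
model) and coins on `ℤ³` (the lifted exploration) — are built in the sequel files.

## References

* S. Martineau, F. Severo, Ann. Probab. 47 (2019), §5 (Structure of the process; Steps `2K+1`,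
  `2K+2`; "By construction, `C_∞` has the distribution of the cluster of the origin for the
  `(p,s)`-process on `ℋ`") [MartineauSevero2019].
* I. Benjamini, O. Schramm, Percolation beyond `ℤ^d`, Electron. Comm. Probab. 1 (1996), Thm. 1
  (lifting the exploration of a spanning tree of the cluster) [BenjaminiSchramm1996].
* G. Grimmett, *Percolation*, 2nd ed. (1999), §7.3 p. 172 (A) (product formula for fresh probes)
  [GrimmettPercolation1999].
-/

namespace Literature.Probability.Percolation

open LatticeModels MeasureTheory ProbeHistory
open scoped ENNReal

namespace SlabTorus

variable {n : ℕ}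

/-! ### The `ℋ`-level state machine -/

/-- A query of the exploration: the `ℋ`-edge `s(a, nbr a d)` probed from its explored endpoint `a`
("`p`-exploration"), or the bonus of the column `y` ("`s`-exploration").
[cite: MartineauSevero2019, §5 (Steps 2K+1, 2K+2)] -/
inductive Query (n : ℕ)
  | edge (a : Vert n) (d : Dir) : Query n
  | col (y : Site 2) : Query n

/-- The number of coins a query reads: `1` for an edge, `T` for a column bonus. [folklore] -/
def qsize (T : ℕ) : Query n → ℕ
  | Query.edge _ _ => 1
  | Query.col _ => T

/-- The state of the exploration (Martineau–Severo's `C_{ℓ,n}` together with the bookkeeping of what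
has been explored): explored vertices `A`, queried edges `Q` with their query data `src`, open
queried edges `O`, columns `Y` whose bonus was attempted. [cite: MartineauSevero2019, §5] -/
structure HState (n : ℕ) where
  /-- explored vertices (the enhanced cluster found so far) -/
  A : Finset (Vert n)
  /-- queried `ℋ`-edges -/
  Q : Finset (Sym2 (Vert n))
  /-- queried `ℋ`-edges found open -/
  O : Finset (Sym2 (Vert n))
  /-- columns whose bonus has been attempted -/
  Y : Finset (Site 2)
  /-- for a queried edge, the endpoint and direction it was queried as -/
  src : Sym2 (Vert n) → Vert n × Dir

/-- The initial state: only the origin is explored. [cite: MartineauSevero2019, §5 (Step 0)] -/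
def HState.init (n : ℕ) : HState n :=
  ⟨{origin n}, ∅, ∅, ∅, fun _ => (origin n, ((0 : Fin 3), true))⟩

/-- The four neighbouring columns of `y`, as vertices of `ℋ_n`: the set added by the bonus of `y`.
[cite: MartineauSevero2019, §4 (S_{r+1}(u))] -/
noncomputable def nbhdVerts [NeZero n] (y : Site 2) : Finset (Vert n) :=
  ((Finset.univ : Finset (ZMod n)) ×ˢ (Finset.univ : Finset (Fin 2 × Bool))).image
    fun q => (q.1, y + if q.2.2 then Pi.single q.2.1 1 else -Pi.single q.2.1 1)

/-- Membership in `nbhdVerts y`: the column of `v` is adjacent to `y`. [folklore] -/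
theorem mem_nbhdVerts_iff [NeZero n] {y : Site 2} {v : Vert n} :
    v ∈ nbhdVerts y ↔ (zdGraph 2).Adj y v.2 := by
  simp only [nbhdVerts, Finset.mem_image, Finset.mem_product, Finset.mem_univ, true_and, zdGraph_adj_iff]
  constructor
  · rintro ⟨⟨t, i, b⟩, rfl⟩
    cases b
    · exact ⟨i, Or.inr (by simp)⟩
    · exact ⟨i, Or.inl (by simp)⟩
  · rintro ⟨i, h | h⟩
    · exact ⟨(v.1, i, true), by ext <;> simp [h]⟩
    · refine ⟨(v.1, i, false), ?_⟩
      ext <;> simp [h]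

/-- A column is *explored-open* in the state `σ` when its `n` vertical edges are queried-open.
[cite: MartineauSevero2019, §5 (Step 2K+2: "whose r-ball is fully open")] -/
def colOpen (σ : HState n) (y : Site 2) : Prop := ∀ t : ZMod n, s(((t, y) : Vert n), (t + 1, y)) ∈ σ.O

open Classical in
/-- **The next query** (`none` = halt): an unexplored edge of `E_L` at an explored vertex if any
(`p`-exploration first), else the bonus of an un-attempted explored-open column of `box L`.
[cite: MartineauSevero2019, §5 (Steps 2K+1, 2K+2)] -/
noncomputable def nq [NeZero n] (L : ℕ) (σ : HState n) : Option (Query n) :=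
  if h : ∃ q : Vert n × Dir, q.1 ∈ σ.A ∧ s(q.1, nbr q.1 q.2) ∈ KE n L ∧ s(q.1, nbr q.1 q.2) ∉ σ.Q then
    some (Query.edge h.choose.1 h.choose.2)
  else if h' : ∃ y : Site 2, y ∈ box 2 L ∧ y ∉ σ.Y ∧ colOpen σ y then some (Query.col h'.choose)
  else none

open Classical in
/-- **One step**: record the query and, on a positive answer, add the far endpoint (edge query) or
the four neighbouring columns (column bonus). [cite: MartineauSevero2019, §5 (Steps 2K+1, 2K+2)] -/
noncomputable def hstep [NeZero n] (σ : HState n) : Query n → Bool → HState n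
  | Query.edge a d, b =>
    { A := if b then insert (nbr a d) σ.A else σ.A
      Q := insert s(a, nbr a d) σ.Q
      O := if b then insert s(a, nbr a d) σ.O else σ.O
      Y := σ.Y
      src := Function.update σ.src s(a, nbr a d) (a, d) }
  | Query.col y, b =>
    { A := if b then σ.A ∪ nbhdVerts y else σ.A
      Q := σ.Q
      O := σ.O
      Y := insert y σ.Y
      src := σ.src }

/-- **The state after a transcript** (answers newest first): replay the machine.
[cite: MartineauSevero2019, §5] -/
noncomputable def stateOf [NeZero n] (L : ℕ) : List Bool → HState n
  | [] => HState.init n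
  | b :: bs => match nq L (stateOf L bs) with
    | none => stateOf L bs
    | some q => hstep (stateOf L bs) q b

/-- Unfolding `stateOf` on a cons. [folklore] -/
theorem stateOf_cons [NeZero n] (L : ℕ) (b : Bool) (bs : List Bool) :
    stateOf (n := n) L (b :: bs) = match nq L (stateOf L bs) with
      | none => stateOf L bs
      | some q => hstep (stateOf L bs) q b := rfl

/-! ### Transcripts of probing histories and the transcript explorer -/

open scoped Classical

section Transcript

variable {W : Type*}

/-- The answer recorded by a probe: were all probed coins open? [folklore] -/
noncomputable def answer (r : ProbeRecord W) : Bool := decide (r.2 = r.1)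

/-- **The Boolean transcript** of a probing history (newest answer first; `none` steps skipped).
[cite: MartineauSevero2019, §5] -/
noncomputable def bt (h : ProbeHistory W) : List Bool := h.filterMap (Option.map answer)

/-- Transcript of the empty history. [folklore] -/
@[simp] theorem bt_nil : bt ([] : ProbeHistory W) = [] := rfl

/-- A `none` step leaves the transcript unchanged. [folklore] -/
@[simp] theorem bt_cons_none (h : ProbeHistory W) : bt (none :: h) = bt h := by
  simp [bt]

/-- A probe appends its answer. [folklore] -/
@[simp] theorem bt_cons_some (r : ProbeRecord W) (h : ProbeHistory W) : bt (some r :: h) = answer r :: bt h := by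
  simp [bt]

variable [NeZero n] (L : ℕ) (enc : List Bool → Query n → Finset (Sym2 W))

/-- The coin set the exploration wants to probe after the transcript `b`: the encoding (which may use
the whole transcript, e.g. through lifted heights) of the next query of the replayed state.
[cite: MartineauSevero2019, §5] -/
noncomputable def wanted (b : List Bool) : Option (Finset (Sym2 W)) :=
  (nq L (stateOf L b)).map (enc b)

/-- No coin set is wanted iff the machine has halted. [folklore] -/
theorem wanted_eq_none_iff (b : List Bool) : wanted L enc b = none ↔ nq L (stateOf (n := n) L b) = none := by
  simp [wanted]

/-- The coin set the exploration wants to probe after history `h`. [cite: MartineauSevero2019, §5] -/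
noncomputable def cand (h : ProbeHistory W) : Option (Finset (Sym2 W)) := wanted L enc (bt h)

/-- **The transcript explorer**: probe `cand h`, unless (defensively) it meets an earlier support, in
which case halt. Along genuine runs the guard never triggers (freshness of the exploration, proved by
the instances); it makes `Explorer.Fresh ∅` hold unconditionally. [cite: MartineauSevero2019, §5 ("No vertex or edge will get explored more than once")] -/
noncomputable def texpl : Explorer W :=
  ⟨fun h => (cand L enc h).bind fun D => if Disjoint D (supp h) then some D else none⟩

/-- The transcript explorer probes `D` iff `D` is the wanted coin set and it is fresh. [folklore] -/
theorem texpl_next_eq_some_iff {h : ProbeHistory W} {D : Finset (Sym2 W)} :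
    (texpl L enc).next h = some D ↔ cand L enc h = some D ∧ Disjoint D (supp h) := by
  simp only [texpl]
  cases hc : cand L enc h with
  | none => simp
  | some D' =>
    simp only [Option.bind_some]
    split_ifs with hd
    · simp only [Option.some.injEq]
      constructor
      · rintro rfl; exact ⟨rfl, hd⟩
      · rintro ⟨rfl, -⟩; rfl
    · constructor
      · intro h'; cases h'
      · rintro ⟨h', hd'⟩
        cases h'
        exact absurd hd' hd

/-- **Freshness** of the transcript explorer (by construction). [cite: MartineauSevero2019, §5] -/
theorem texpl_fresh : (texpl L enc).Fresh (∅ : Set (Sym2 W)) := by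
  intro h D hD
  exact ⟨Set.disjoint_empty _, ((texpl_next_eq_some_iff L enc).1 hD).2⟩

/-- The transcript after one more step of the transcript explorer. [folklore] -/
theorem bt_hist_succ (k : ℕ) (ω : BondConfig W) :
    bt ((texpl L enc).hist (k + 1) ω) =
      match (texpl L enc).next ((texpl L enc).hist k ω) with
      | none => bt ((texpl L enc).hist k ω)
      | some D => decide (obs ω D = D) :: bt ((texpl L enc).hist k ω) := by
  rw [Explorer.hist_succ]
  cases hD : (texpl L enc).next ((texpl L enc).hist k ω) with
  | none => rw [Explorer.step_of_none _ hD]; simp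
  | some D => rw [Explorer.step_of_some _ hD]; simp [answer]

/-- The hypotheses on an encoding: probes are `qsize`-many genuine edges, and along every run the
wanted coin set is fresh. [cite: MartineauSevero2019, §5] -/
structure GoodEnc (L T : ℕ) (enc : List Bool → Query n → Finset (Sym2 W)) (G : SimpleGraph W) : Prop where
  /-- probed coins are edges of the graph -/
  sub : ∀ b q, nq L (stateOf (n := n) L b) = some q → (↑(enc b q) : Set (Sym2 W)) ⊆ G.edgeSet
  /-- an edge query reads one coin, a column query reads `T` coins -/
  card : ∀ b q, nq L (stateOf (n := n) L b) = some q → (enc b q).card = qsize T q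
  /-- along every run, the wanted coins are fresh -/
  fresh : ∀ (k : ℕ) (ω : BondConfig W) (D : Finset (Sym2 W)),
    cand L enc ((texpl L enc).hist k ω) = some D → Disjoint D (supp ((texpl L enc).hist k ω))

variable {L enc}

/-- Along a run the defensive guard never triggers: the explorer probes exactly the wanted coins.
[cite: MartineauSevero2019, §5] -/
theorem next_hist_eq {T : ℕ} {G : SimpleGraph W} (hE : GoodEnc (n := n) L T enc G) (k : ℕ) (ω : BondConfig W) :
    (texpl L enc).next ((texpl L enc).hist k ω) = wanted L enc (bt ((texpl L enc).hist k ω)) := by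
  change _ = cand L enc ((texpl L enc).hist k ω)
  cases hc : cand L enc ((texpl L enc).hist k ω) with
  | none =>
    cases hD : (texpl L enc).next ((texpl L enc).hist k ω) with
    | none => rfl
    | some D =>
      have := ((texpl_next_eq_some_iff L enc).1 hD).1
      rw [hc] at this
      cases this
  | some D => exact (texpl_next_eq_some_iff L enc).2 ⟨hc, hE.fresh k ω D hc⟩

/-- **The transcript recursion along a run**: the new transcript is the old one, extended by the
answer to the wanted probe if there is one. [cite: MartineauSevero2019, §5] -/
theorem bt_hist_succ_eq {T : ℕ} {G : SimpleGraph W} (hE : GoodEnc (n := n) L T enc G) (k : ℕ) (ω : BondConfig W) :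
    bt ((texpl L enc).hist (k + 1) ω) =
      match wanted L enc (bt ((texpl L enc).hist k ω)) with
      | none => bt ((texpl L enc).hist k ω)
      | some D => decide (obs ω D = D) :: bt ((texpl L enc).hist k ω) := by
  rw [bt_hist_succ, next_hist_eq hE]

end Transcript

/-! ### The law of the transcript -/

section Law

variable {W : Type*} (G : SimpleGraph W) (p : unitInterval)

/-- The probability of a positive answer to a probe of `D ⊆ E(G)`: `p ^ |D|`. [folklore] -/
theorem measureReal_all_open {D : Finset (Sym2 W)} (hD : (↑D : Set (Sym2 W)) ⊆ G.edgeSet) :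
    (bondPercolation G p).real {ω | obs ω D = D} = (p : ℝ) ^ D.card := by
  have : {ω : BondConfig W | obs ω D = D} = {ω | (↑D : Set (Sym2 W)) ⊆ ω} := by
    ext ω
    simp only [Set.mem_setOf_eq]
    constructor
    · intro h e he
      have : e ∈ obs ω D := h.symm ▸ he
      exact (mem_obs_iff.1 this).2
    · intro h
      ext e
      simp only [mem_obs_iff, and_iff_left_iff_imp]
      exact fun he => h he
  rw [this, bondPercolation_real_setOf_subset G p D hD]

/-- The probability of a negative answer: `1 - p ^ |D|`. [folklore] -/
theorem measureReal_not_all_open {D : Finset (Sym2 W)} (hD : (↑D : Set (Sym2 W)) ⊆ G.edgeSet) :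
    (bondPercolation G p).real {ω | ¬ obs ω D = D} = 1 - (p : ℝ) ^ D.card := by
  have hm : MeasurableSet {ω : BondConfig W | obs ω D = D} := measurableSet_setOf_obs D (· = D)
  have : {ω : BondConfig W | ¬ obs ω D = D} = {ω | obs ω D = D}ᶜ := by ext ω; simp
  rw [this, measureReal_compl hm, probReal_univ, measureReal_all_open G p hD]

/-- The probability that the answer to a probe of `D ⊆ E(G)` is `a`. [folklore] -/
theorem measureReal_answer_eq {D : Finset (Sym2 W)} (hD : (↑D : Set (Sym2 W)) ⊆ G.edgeSet) (a : Bool) :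
    (bondPercolation G p).real {ω | decide (obs ω D = D) = a} =
      if a then (p : ℝ) ^ D.card else 1 - (p : ℝ) ^ D.card := by
  cases a
  · have : {ω : BondConfig W | decide (obs ω D = D) = false} = {ω | ¬ obs ω D = D} := by ext ω; simp
    rw [this]
    exact measureReal_not_all_open G p hD
  · have : {ω : BondConfig W | decide (obs ω D = D) = true} = {ω | obs ω D = D} := by ext ω; simp
    rw [this]
    exact measureReal_all_open G p hD

variable [Countable W] [NeZero n] {L T : ℕ} {enc : List Bool → Query n → Finset (Sym2 W)} {G}

/-- The transcript events are measurable. [folklore] -/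
theorem measurableSet_bt (L : ℕ) (enc : List Bool → Query n → Finset (Sym2 W)) (k : ℕ) (P : List Bool → Prop) :
    MeasurableSet {ω : BondConfig W | P (bt ((texpl L enc).hist k ω))} :=
  (texpl L enc).measurableSet_setOf_hist' k fun h => P (bt h)

/-- **The law of the transcript, one step** (Martineau–Severo, §5: each step reads fresh coins, so
the next answer is `true` with probability `p ^ qsize` given the past): for every `b`,
`P(bt_{k+1} = b) = 1[halted after b] P(bt_k = b) + 1[b = a :: b₀, query q after b₀] P(bt_k = b₀) P(answer a | q)`.
[cite: MartineauSevero2019, §5] -/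
theorem measureReal_bt_succ (hE : GoodEnc (n := n) L T enc G) (k : ℕ) (b : List Bool) :
    (bondPercolation G p).real {ω | bt ((texpl L enc).hist (k + 1) ω) = b} =
      (if nq L (stateOf (n := n) L b) = none then (bondPercolation G p).real {ω | bt ((texpl L enc).hist k ω) = b} else 0) +
      (match b with
        | [] => 0
        | a :: b₀ => match nq L (stateOf (n := n) L b₀) with
          | none => 0
          | some q => (bondPercolation G p).real {ω | bt ((texpl L enc).hist k ω) = b₀} *
              (if a then (p : ℝ) ^ qsize T q else 1 - (p : ℝ) ^ qsize T q)) := by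
  -- the two disjoint pieces of `{bt_{k+1} = b}`
  set X₁ : Set (BondConfig W) := {ω | bt ((texpl L enc).hist k ω) = b ∧ wanted L enc b = none} with hX₁
  set X₂ : Set (BondConfig W) := {ω | ∃ (a : Bool) (b₀ : List Bool) (D : Finset (Sym2 W)), b = a :: b₀ ∧
      bt ((texpl L enc).hist k ω) = b₀ ∧ wanted L enc b₀ = some D ∧ decide (obs ω D = D) = a} with hX₂
  have hsplit : {ω | bt ((texpl L enc).hist (k + 1) ω) = b} = X₁ ∪ X₂ := by
    ext ω
    simp only [Set.mem_setOf_eq, Set.mem_union, hX₁, hX₂]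
    rw [bt_hist_succ_eq hE]
    cases hw : wanted L enc (bt ((texpl L enc).hist k ω)) with
    | none =>
      simp only
      constructor
      · intro h
        exact Or.inl ⟨h, h ▸ hw⟩
      · rintro (⟨h, -⟩ | ⟨a, b₀, D, rfl, hb₀, hD, -⟩)
        · exact h
        · rw [hb₀] at hw
          rw [hw] at hD
          cases hD
    | some D =>
      simp only
      constructor
      · intro h
        exact Or.inr ⟨_, _, D, h.symm, rfl, hw, rfl⟩
      · rintro (⟨h, hnone⟩ | ⟨a, b₀, D', rfl, hb₀, hD', ha⟩)
        · exfalso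
          rw [h] at hw
          rw [hw] at hnone
          cases hnone
        · subst hb₀
          rw [hw] at hD'
          cases hD'
          rw [ha]
  have hdisj : Disjoint X₁ X₂ := by
    rw [Set.disjoint_left]
    rintro ω ⟨h1, -⟩ ⟨a, b₀, D, rfl, hb₀, -, -⟩
    rw [h1] at hb₀
    have hlen := congrArg List.length hb₀
    simp at hlen
  have hX₁m : MeasurableSet X₁ :=
    measurableSet_bt L enc k fun l => l = b ∧ wanted L enc b = none
  -- the halting part
  have hμ₁ : (bondPercolation G p).real X₁ =
      if nq L (stateOf (n := n) L b) = none then (bondPercolation G p).real {ω | bt ((texpl L enc).hist k ω) = b} else 0 := by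
    by_cases hq : nq L (stateOf (n := n) L b) = none
    · have hw : wanted L enc b = none := (wanted_eq_none_iff L enc b).2 hq
      simp only [hq, if_true, hX₁, hw, and_true]
    · have hw : wanted L enc b ≠ none := fun h => hq ((wanted_eq_none_iff L enc b).1 h)
      simp only [hq, if_false]
      have : X₁ = ∅ := by ext ω; simp [hX₁, hw]
      rw [this, measureReal_empty]
  -- the probing part
  cases b with
  | nil =>
    have hX₂e : X₂ = ∅ := by ext ω; simp [hX₂]
    rw [hsplit, hX₂e, Set.union_empty, hμ₁]
    simp
  | cons a b₀ =>
    simp only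
    cases hq : nq L (stateOf (n := n) L b₀) with
    | none =>
      have hw : wanted L enc b₀ = none := (wanted_eq_none_iff L enc b₀).2 hq
      have hX₂e : X₂ = ∅ := by
        ext ω
        simp only [hX₂, Set.mem_setOf_eq, Set.mem_empty_iff_false, iff_false, not_exists, not_and]
        rintro a' b₀' D hb hb' hD -
        simp only [List.cons.injEq] at hb
        obtain ⟨rfl, rfl⟩ := hb
        rw [hw] at hD
        cases hD
      rw [hsplit, hX₂e, Set.union_empty, hμ₁]
      simp
    | some q =>
      simp only
      set D₀ : Finset (Sym2 W) := enc b₀ q with hD₀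
      have hw : wanted L enc b₀ = some D₀ := by simp [wanted, hq, hD₀]
      set Φ : ProbeHistory W → Prop := fun h => bt h = b₀ with hΦ
      set ψ : ProbeHistory W → Finset (Sym2 W) → Prop := fun _ o => decide (o = D₀) = a with hψ
      have hX₂eq : X₂ = Set.univ ∩ {ω | Φ ((texpl L enc).hist k ω) ∧
          ∃ D, (texpl L enc).next ((texpl L enc).hist k ω) = some D ∧ ψ ((texpl L enc).hist k ω) (obs ω D)} := by
        ext ω
        simp only [hX₂, hΦ, hψ, Set.mem_setOf_eq, Set.univ_inter, List.cons.injEq]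
        rw [next_hist_eq hE k ω]
        constructor
        · rintro ⟨a', b₀', D, ⟨rfl, rfl⟩, hb, hD, hans⟩
          rw [hw] at hD
          cases hD
          exact ⟨hb, D₀, by rw [hb, hw], hans⟩
        · rintro ⟨hb, D, hD, hans⟩
          rw [hb, hw] at hD
          cases hD
          exact ⟨a, b₀, D₀, ⟨rfl, rfl⟩, hb, hw, hans⟩
      have hYeq : {ω | bt ((texpl L enc).hist k ω) = b₀} =
          Set.univ ∩ {ω | Φ ((texpl L enc).hist k ω) ∧ (texpl L enc).next ((texpl L enc).hist k ω) ≠ none} := by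
        ext ω
        simp only [hΦ, Set.mem_setOf_eq, Set.univ_inter, ne_eq, iff_self_and]
        intro hb
        rw [next_hist_eq hE k ω, hb, hw]
        exact Option.some_ne_none _
      set c : ℝ := if a then (p : ℝ) ^ qsize T q else 1 - (p : ℝ) ^ qsize T q with hc
      have hc0 : 0 ≤ c := by
        rw [hc]
        split_ifs
        · exact pow_nonneg p.2.1 _
        · have : (p : ℝ) ^ qsize T q ≤ 1 := pow_le_one₀ p.2.1 p.2.2
          linarith
      have hcval : ∀ h D, (texpl L enc).next h = some D → Φ h →
          bondPercolation G p {ω | ψ h (obs ω D)} = ENNReal.ofReal c := by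
        intro h D hD hh
        have hcand := ((texpl_next_eq_some_iff L enc).1 hD).1
        have hDD : D = D₀ := by
          change wanted L enc (bt h) = some D at hcand
          rw [show bt h = b₀ from hh, hw] at hcand
          cases hcand
          rfl
        subst hDD
        rw [← ofReal_measureReal (measure_ne_top _ _)]
        congr 1
        simp only [hψ]
        rw [measureReal_answer_eq G p (hE.sub _ _ hq), hE.card _ _ hq, hc]
      have hle := (texpl L enc).measure_inter_setOf_step_le G p (texpl_fresh L enc) (determinedBy_univ _)
        MeasurableSet.univ k Φ ψ (ENNReal.ofReal c) fun h D hD hh => (hcval h D hD hh).le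
      have hge := (texpl L enc).le_measure_inter_setOf_step G p (texpl_fresh L enc) (determinedBy_univ _)
        MeasurableSet.univ k Φ ψ (ENNReal.ofReal c) fun h D hD hh => (hcval h D hD hh).ge
      have heq : bondPercolation G p X₂ = ENNReal.ofReal c * bondPercolation G p {ω | bt ((texpl L enc).hist k ω) = b₀} := by
        rw [hX₂eq, hYeq]
        exact le_antisymm hle hge
      have hX₂m : MeasurableSet X₂ := by
        have : X₂ = {ω | bt ((texpl L enc).hist k ω) = b₀} ∩ {ω | decide (obs ω D₀ = D₀) = a} := by
          ext ω
          simp only [hX₂, Set.mem_setOf_eq, Set.mem_inter_iff, List.cons.injEq]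
          constructor
          · rintro ⟨a', b₀', D, ⟨rfl, rfl⟩, hb, hD, hans⟩
            rw [hw] at hD; cases hD
            exact ⟨hb, hans⟩
          · rintro ⟨hb, hans⟩
            exact ⟨a, b₀, D₀, ⟨rfl, rfl⟩, hb, hw, hans⟩
        rw [this]
        exact (measurableSet_bt L enc k (· = b₀)).inter (measurableSet_setOf_obs D₀ fun o => decide (o = D₀) = a)
      rw [hsplit, measureReal_union hdisj hX₂m, hμ₁]
      congr 1
      rw [measureReal_def, heq, ENNReal.toReal_mul, ENNReal.toReal_ofReal hc0, ← measureReal_def, mul_comm]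

omit [Countable W] in
/-- At time `0` the transcript is empty. [folklore] -/
theorem measureReal_bt_zero (L : ℕ) (enc : List Bool → Query n → Finset (Sym2 W)) (b : List Bool) :
    (bondPercolation G p).real {ω | bt ((texpl L enc).hist 0 ω) = b} = if b = [] then 1 else 0 := by
  by_cases hb : b = []
  · subst hb; simp
  · simp only [Explorer.hist_zero, bt_nil, hb, if_false]
    have : {ω : BondConfig W | ([] : List Bool) = b} = ∅ := by
      ext ω
      simp only [Set.mem_setOf_eq, Set.mem_empty_iff_false, iff_false]
      exact fun h => hb h.symm
    rw [this, measureReal_empty]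

/-- The probability of an event read off the transcript is the sum over transcripts. [folklore] -/
theorem measureReal_setOf_bt_eq_tsum (L : ℕ) (enc : List Bool → Query n → Finset (Sym2 W)) (k : ℕ)
    (P : List Bool → Prop) :
    (bondPercolation G p).real {ω | P (bt ((texpl L enc).hist k ω))} =
      ∑' b : List Bool, if P b then (bondPercolation G p).real {ω | bt ((texpl L enc).hist k ω) = b} else 0 := by
  have hU : {ω : BondConfig W | P (bt ((texpl L enc).hist k ω))} =
      ⋃ b : List Bool, {ω | bt ((texpl L enc).hist k ω) = b ∧ P b} := by
    ext ω
    simp only [Set.mem_setOf_eq, Set.mem_iUnion]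
    exact ⟨fun h => ⟨_, rfl, h⟩, fun ⟨b, hb, h⟩ => hb ▸ h⟩
  have hd : Pairwise (Function.onFun Disjoint fun b : List Bool =>
      {ω : BondConfig W | bt ((texpl L enc).hist k ω) = b ∧ P b}) := by
    intro b b' hne
    exact Set.disjoint_left.2 fun ω h h' => hne (h.1.symm.trans h'.1)
  have hm : ∀ b : List Bool, MeasurableSet {ω : BondConfig W | bt ((texpl L enc).hist k ω) = b ∧ P b} :=
    fun b => measurableSet_bt L enc k fun l => l = b ∧ P b
  rw [hU, measureReal_def, measure_iUnion hd hm, ENNReal.tsum_toReal_eq fun b => measure_ne_top _ _]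
  refine tsum_congr fun b => ?_
  by_cases hP : P b
  · simp only [hP, and_true, if_true, measureReal_def]
  · simp only [hP, and_false, Set.setOf_false, measure_empty, ENNReal.toReal_zero, if_false]

end Law

/-! ### Two explorations with the same queries have the same transcript law -/

section TwoLaws

variable {W₁ W₂ : Type*} [Countable W₁] [Countable W₂] [NeZero n] {L T : ℕ}
  {enc₁ : List Bool → Query n → Finset (Sym2 W₁)} {enc₂ : List Bool → Query n → Finset (Sym2 W₂)}
  {G₁ : SimpleGraph W₁} {G₂ : SimpleGraph W₂} (p : unitInterval)
  (h₁ : GoodEnc (n := n) L T enc₁ G₁) (h₂ : GoodEnc (n := n) L T enc₂ G₂)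
include h₁ h₂

/-- **Equality of transcript laws** (Martineau–Severo, §5: "By construction, `C_∞` has the
distribution of the cluster of the origin for the `(p,s)`-process on `ℋ`"): two good encodings of
the same `ℋ`-level exploration, read on possibly different graphs at the same `p`, give transcripts
with the same law. [cite: MartineauSevero2019, §5 (Proposition 4.1, conclusion)] -/
theorem measureReal_bt_eq (k : ℕ) (b : List Bool) :
    (bondPercolation G₁ p).real {ω | bt ((texpl L enc₁).hist k ω) = b} =
      (bondPercolation G₂ p).real {ω | bt ((texpl L enc₂).hist k ω) = b} := by
  induction k generalizing b with
  | zero => rw [measureReal_bt_zero, measureReal_bt_zero]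
  | succ k ih =>
    rw [measureReal_bt_succ p h₁, measureReal_bt_succ p h₂, ih]
    congr 1
    cases b with
    | nil => rfl
    | cons a b₀ =>
      simp only
      cases nq L (stateOf (n := n) L b₀) with
      | none => rfl
      | some q => rw [ih]

/-- **Equal probabilities of transcript events**: any event read off the transcript at time `k` has
the same probability for the two explorations. [cite: MartineauSevero2019, §5 (Proposition 4.1, conclusion)] -/
theorem measureReal_setOf_bt_eq (k : ℕ) (P : List Bool → Prop) :
    (bondPercolation G₁ p).real {ω | P (bt ((texpl L enc₁).hist k ω))} =
      (bondPercolation G₂ p).real {ω | P (bt ((texpl L enc₂).hist k ω))} := by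
  rw [measureReal_setOf_bt_eq_tsum p L enc₁ k P, measureReal_setOf_bt_eq_tsum p L enc₂ k P]
  exact tsum_congr fun b => by rw [measureReal_bt_eq p h₁ h₂]

end TwoLaws

end SlabTorus

end Literature.Probability.Percolation
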